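import Mathlib
import HarnessLib

/-!
# The local Gehring lemma on doubling metric measure spaces (self-improvement of weak reverse Hölder
# inequalities) — named fact, counting-measure special case

Topic `Literature/Analysis/PDE` (regularity theory / analysis on metric spaces). ONE named fact (D-0014:
`def … : Prop`, no proof): the LOCAL self-improving property of WEAK reverse Hölder inequalities (a
larger ball on the right) on a metric measure space with a DOUBLING measure, in the special case of the
COUNTING measure on a locally finite point set.

> **Lemma 4.1** of J. Kinnunen, A. Nastasi, C. Pacchiano Camacho, *Gradient higher integrability for
> double phase problems on metric measure spaces*, Proc. Amer. Math. Soc. **152** (2024) 1233–1251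
> [KinnunenNastasiCamacho2023] (p. 10 of the arXiv text 2304.14858 materialised in the tree's
> store; "whose proof can be found, for example, in [1] or [39]" = [BjornBjorn2011], [ZatorskaGoldstein2005]):
> Let `f ∈ L¹_loc(Ω)` and `g ∈ L^σ_loc(X)`, `σ > 1`, be non-negative functions and let `λ > 1`. Assume that
> there exist a constant `C₁` and an exponent `0 < d < 1` such that
> `⨍_{B_R} f dμ ≤ C₁ ( (⨍_{B_{λR}} f^d dμ)^{1/d} + ⨍_{B_{λR}} g dμ )`
> for every ball `B_R` with `B_{λR} ⋐ Ω`. Then there exist a constant `C₂ = C₂(C_D, C₁, d, λ)` and an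
> exponent `ε = ε(C_D, C₁, d, λ) > 0` such that
> `(⨍_{B_R} f^{1+ε} dμ)^{1/(1+ε)} ≤ C₂ ( ⨍_{B_{λR}} f dμ + (⨍_{B_{λR}} g^σ dμ)^{1/σ} )`
> for every ball `B_R` with `B_{λR} ⋐ Ω`.
> Standing assumptions of loc. cit. §2 (p. 2–3): `(X, d, μ)` is a complete metric measure space, `μ` Borel
> regular and doubling, `0 < μ(B_{2r}) ≤ C_D μ(B_r) < ∞` for every ball `B_r = B_r(x) = {y : d(y,x) < r}`,
> `x ∈ X`, `0 < r < ∞`; `Ω ⊂ X` open.  (Loc. cit. also assumes a weak `(1,p)`-Poincaré inequality for the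
> paper's main theorems; the lemma is the doubling-only metric Gehring lemma of [ZatorskaGoldstein2005] and
> [BjornBjorn2011, Ch. 3] — "this lemma holds in all doubling metric measure spaces", A. Nastasi,
> C. Pacchiano Camacho [NastasiCamacho2022], J. Differential Equations (2023), arXiv 2203.07699 p. 10, Lemma 4.1 = its global twin; the
> doubling-only proofs in print: O. E. Maasalo [Maasalo2007], *The Gehring lemma in metric spaces*, arXiv 0704.3916,
> Thm. 3.1 (global form), and P. Auscher, S. Bortz, M. Egert, O. Saari [AuscherEtAl2017], J. Geom. Anal. (2019),
> arXiv 1707.02080, Thm. 1 / Cor. 17 (local form on open subsets of doubling metric spaces).)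
> Euclidean ancestor: F. W. Gehring, Acta Math. 130 (1973) 265–277; M. Giaquinta, G. Modica (1979), in the
> form of [giaquinta1984, Ch. V, Prop. 1.1 / Thm. 1.2] (PDF p. 71–72 of the store text).

## Formalisation choices (each makes the fact weaker than or equal to print)

* THE SPACE is a locally finite subset `S` of a complete metric space `X` (every ball of `X` meets `S` in a
  finite set), with the induced metric and the COUNTING measure: `S` is closed, hence complete; every
  subset of the discrete space `S` is Borel, so counting measure is Borel regular; a ball of the space `S`
  is `S ∩ ball x r` with CENTRE `x ∈ S` (open balls, as in print), it contains `x`, so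
  `0 < #(S ∩ ball x r) < ∞`; DOUBLING is the hypothesis `#(S ∩ ball x (2r)) ≤ C_D · #(S ∩ ball x r)` for all
  `x ∈ S`, `0 < r`; the mean value `⨍_B h dμ` is the finite average `finavg (S ∩ ball x r) h =
  (Σ_{y ∈ S ∩ ball x r} h y) / #(S ∩ ball x r)`; every non-negative function on `S` is locally integrable.
* THE OPEN SET: `Ω` ranges over subsets of `X` open in `X` (their traces on `S` are open in `S`; fewer
  instances than print).  In the discrete space `S` every ball `S ∩ ball x (λR)` is finite, hence compact,
  so `B_{λR} ⋐ Ω` is exactly `S ∩ ball x (λR) ⊆ Ω`.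
* FUNCTIONS `f g : X → ℝ`, non-negative on `S` (only values on `S` are ever summed); real powers are
  `Real.rpow` of non-negative means.
* CONSTANTS: print gives `C₂, ε` depending only on `(C_D, C₁, d, λ)`; here they may depend on
  `(C_D, C₁, d, λ, σ)` (the existential comes after all five parameters and before the space, the set `S`,
  `Ω`, `f`, `g`) — weaker than print.  The side conditions `1 ≤ C_D`, `0 < C₁` are extra hypotheses.
  -- TODO(general form): an arbitrary complete metric measure space with a doubling Borel regular measure
  -- (Mathlib: a `Measure` on a `MetricSpace` with the global doubling inequality), `⨍` as `MeasureTheory.average`.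

Wanted by `Summit.AtomisticToContinuum.Crystallization` (statement 26636, line `_16XH19(_tol)`): the
higher-integrability step «(M♭) ⟸ [C] rigid Caccioppoli ∧ Gehring» for the strain profile `σ` of a registered
window of a door set (`S` δ-separated and relatively dense: counting measure doubling at every scale with
`C_D = C_D(δ)`; `f = σ²`, `d = s/2`; `Ω` = the open window; MEMO-g43-M.md §3, FACT-g43-GehringLemma.md).

## References

* [KinnunenNastasiCamacho2023] J. Kinnunen, A. Nastasi, C. Pacchiano Camacho, Proc. Amer. Math.
  Soc. 152 (2024) 1233–1251, Lemma 4.1 (arXiv:2304.14858, p. 10).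
* [ZatorskaGoldstein2005] A. Zatorska-Goldstein, *Very weak solutions of nonlinear subelliptic equations*,
  Ann. Acad. Sci. Fenn. Math. 30 (2005) 407–436.
* [BjornBjorn2011] A. Björn, J. Björn, *Nonlinear Potential Theory on Metric Spaces*, EMS Tracts in
  Mathematics 17 (2011), Ch. 3.
* [Maasalo2007] O. E. Maasalo, *The Gehring lemma in metric spaces*, arXiv:0704.3916, Thm. 3.1.
* [NastasiCamacho2022] A. Nastasi, C. Pacchiano Camacho, J. Differential Equations (2023), Lemma 4.1
  (arXiv:2203.07699, p. 10).
* [AuscherEtAl2017] P. Auscher, S. Bortz, M. Egert, O. Saari, *Non-local Gehring lemmas in spaces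
  of homogeneous type and applications*, J. Geom. Anal. (2019), Thm. 1, Cor. 17 (arXiv:1707.02080).
* [Gehring1973] F. W. Gehring, Acta Math. 130 (1973) 265–277.
-/

noncomputable section

open Metric

namespace Literature.Analysis.PDE

/-- The finite average `(Σ_{y ∈ K} h y) / #K` of a real function over a (finite) set — the mean value
`⨍_K h dμ` for the counting measure (plumbing for the statement below). [folklore] -/
def finavg {X : Type*} (K : Set X) (h : X → ℝ) : ℝ := (∑ᶠ y ∈ K, h y) / (K.ncard : ℝ)

/-- NAMED FACT — **the local Gehring lemma on doubling metric measure spaces (Zatorska-Goldstein 2005;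
Björn–Björn 2011, Ch. 3; quoted as Lemma 4.1 of Kinnunen–Nastasi–Pacchiano Camacho 2023/24), counting-measure
special case.**  For `C_D ≥ 1`, `C₁ > 0`, `0 < d < 1`, `λ > 1`, `σ > 1` there are `C₂` and `ε > 0` such that:
for every locally finite subset `S` of a complete metric space whose counting measure is `C_D`-doubling on
balls centred in `S`, every open `Ω`, and all `f, g ≥ 0` on `S` with
`⨍_{S ∩ B(x,R)} f ≤ C₁ ((⨍_{S ∩ B(x,λR)} f^d)^{1/d} + ⨍_{S ∩ B(x,λR)} g)` for all `x ∈ S`, `R > 0` with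
`S ∩ B(x,λR) ⊆ Ω`, one has `(⨍_{S ∩ B(x,R)} f^{1+ε})^{1/(1+ε)} ≤ C₂ (⨍_{S ∩ B(x,λR)} f + (⨍_{S ∩ B(x,λR)} g^σ)^{1/σ})`
for all such balls.
[cite: KinnunenNastasiCamacho2023, Lemma 4.1 (counting measure on a locally finite set)]
[cite: ZatorskaGoldstein2005] [cite: BjornBjorn2011, Ch. 3] -/
def ZatorskaGoldstein2005_localGehringLemmaCounting : Prop :=
  ∀ (CD C₁ d lam σ : ℝ), 1 ≤ CD → 0 < C₁ → 0 < d → d < 1 → 1 < lam → 1 < σ →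
    ∃ C₂ : ℝ, ∃ ε : ℝ, 0 < ε ∧
      ∀ (X : Type) [MetricSpace X] [CompleteSpace X] (S : Set X),
        (∀ (x : X) (r : ℝ), (S ∩ ball x r).Finite) →
        (∀ x ∈ S, ∀ r : ℝ, 0 < r → ((S ∩ ball x (2 * r)).ncard : ℝ) ≤ CD * ((S ∩ ball x r).ncard : ℝ)) →
        ∀ (Ω : Set X), IsOpen Ω →
        ∀ (f g : X → ℝ), (∀ x ∈ S, 0 ≤ f x) → (∀ x ∈ S, 0 ≤ g x) →
          (∀ x ∈ S, ∀ R : ℝ, 0 < R → S ∩ ball x (lam * R) ⊆ Ω →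
              finavg (S ∩ ball x R) f ≤
                C₁ * ((finavg (S ∩ ball x (lam * R)) (fun y => f y ^ d)) ^ (1 / d) +
                  finavg (S ∩ ball x (lam * R)) g)) →
          ∀ x ∈ S, ∀ R : ℝ, 0 < R → S ∩ ball x (lam * R) ⊆ Ω →
            (finavg (S ∩ ball x R) (fun y => f y ^ (1 + ε))) ^ (1 / (1 + ε)) ≤
              C₂ * (finavg (S ∩ ball x (lam * R)) f +
                (finavg (S ∩ ball x (lam * R)) (fun y => g y ^ σ)) ^ (1 / σ))

end Literature.Analysis.PDE

end
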